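import Mathlib.Algebra.Module.CharacterModule
import Mathlib.GroupTheory.QuotientGroup.Basic
import Mathlib.GroupTheory.Coset.Card
import Mathlib.Algebra.Group.Subgroup.Finite
import Mathlib.Data.Set.Card
import Mathlib.Order.Lattice.Nat
import Literature.GroupTheory.FiniteAbelian.CharacterModuleUnitAddCircle
import Summits.BirchSwinnertonDyer.BirchSwinnertonDyer.Theorems.ResidualThetaTransportAtTwoResidualSignedLambdaLowerCMAtTwoDualityGlue
import HarnessLib

/-!
# stub_cmLambdaLower · k3 · gen 8 — the DUAL-SIDE CUT of the hardest stub `S4rel`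

HONEST FRAMING.  BSD is NOT proved by any of this.  RSL_g (`stmt-BirchSwinnertonDyer-22608`,
= `stub_cmLambdaLower` BY NAME) and (R≥)ᵖ (`stmt-BirchSwinnertonDyer-26074`) are OPEN.  This file is a
stub-ideation SKETCH (technique family: decomposition with a PROVED glue).  It re-types nothing of the
route; it proves, over abstract carriers, the glue of a decomposition of the critic's hardest sub-stub
`S4rel = stub_deepHalfRelaxed` (STUB-PLAN rev 9 §3 item 4, V14) into two sub-stubs that live on the two
SIDES of Pontryagin duality, plus the generic «eventual range» lemma the discrete half consumes.

Dictionary (rev 9, V14): `A := 𝒪`; `L := D₂ × DS = ⊕_{v ∈ S} H¹(ℚ_{∞,v}, A_ρ)` (DISCRETE local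
cohomology at `S = {2} ∪ S₀`); `Sel := SelRel = H¹(ℚ_S/ℚ_∞, A_ρ)` with `loc : Sel →ₗ[A] L`;
`H := I.H` (Kato's `IwasawaH1DataCoeff.H`) with `locd := loc' : I.H → L⋆ = D₂⋆ × DS⋆`
(`L⋆ := CharacterModule L` is the Pontryagin model of `⊕_{v∈S} H¹_Iw(ℚ_v, T_ρ)`).

* `DeepHalf loc locd`          = (DH)_rel = the binder `hDHrel` of k3-g7's G3 / `hDH` of p664041
                                 (`P := CharacterModule L`, `pair := CharacterModule.dual loc`).
* `DiscreteDeepHalf loc locd`  = S4d (DDH): the deep half stated on the DISCRETE side —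
                                 «`∃ a₀ ≠ 0, ∀ ℓ ∈ L, ℓ ⊥ locd(I.H) → a₀ • ℓ ∈ loc(SelRel)`».
* `LevelwiseImage locd`        = S4b (LW): «a character of `L` that agrees with SOME `locd x_N` on every
                                 finite subgroup of `L` is `locd x` up to a non-zero scalar» — the limit
                                 bookkeeping of TP2's `poitouTateDeep_of_levelwise` with the Poitou–Tate
                                 input REMOVED (the inverse system is the tautological one, `proj (I.H)`).
* `ChainwiseImage locd Lc`     = S4b′ (CW): the same on a fixed tower `Lc N` of finite subgroups (the
                                 prover's solution sets are indexed by `N`); `S4b′ ⇒ S4b` trivially.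
* GLUE (all PROVED, 0 sorry):  `mem_of_forall_apply_eq_zero` (finite Pontryagin biduality
  `W₁ = W₁^{⊥⊥}` for characters of a finite group), `exists_mem_eqOn_of_forall_ann` (its finite-subgroup
  form for an arbitrary group), `closedImage_of_levelwise`, `deepHalf_of_discrete_of_closed`,
  `deepHalf_of_discrete_of_levelwise` (S4d → S4b → S4rel).
* `exists_eventually_range_eq` + `exists_compatible_of_forall_mem_range` = (EVR), the «eventual range
  = image of the limit» lemma for towers of finite sets, from the LANDED Kőnig lemma
  `CharIdealLambda.exists_compatible_preimage` (…DualityGlue.lean) — the only limit passage S4d needs.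
-/

set_option linter.dupNamespace false

namespace Summit.BirchSwinnertonDyer.BirchSwinnertonDyer.Cruxes.ResidualThetaCountLowerPureAtTwo.StubIdeasK3G8

open Function

/-! ## §1 Finite Pontryagin biduality for `CharacterModule` (= `· →+ ℚ/ℤ`) -/

section FiniteBiduality

variable {G : Type*} [AddCommGroup G]

/-- `#X⋆ = #X` and `X⋆` finite, for a finite abelian group `X` (tree: `CharacterModule X ≃+ X`). -/
theorem finite_and_natCard_characterModule (X : Type*) [AddCommGroup X] [Finite X] :
    Finite (CharacterModule X) ∧ Nat.card (CharacterModule X) = Nat.card X := by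
  obtain ⟨e⟩ := Literature.GroupTheory.FiniteAbelian.nonempty_characterModule_addEquiv X
  exact ⟨Finite.of_equiv X e.toEquiv.symm, Nat.card_congr e.toEquiv⟩

/-- Evaluation `g ↦ (w ↦ w g)` of the characters in a subgroup `W₁ ≤ G⋆` : `G →+ W₁⋆`. -/
noncomputable def evalOn (W₁ : AddSubgroup (CharacterModule G)) : G →+ CharacterModule W₁ :=
  AddMonoidHom.mk'
    (fun g => (AddMonoidHom.mk' (fun w : W₁ => (w : CharacterModule G) g)
      (fun _ _ => rfl) : W₁ →+ AddCircle (1 : ℚ)))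
    (fun g g' => by
      ext w
      exact map_add (w : CharacterModule G) g g')

theorem evalOn_apply (W₁ : AddSubgroup (CharacterModule G)) (g : G) (w : W₁) :
    evalOn W₁ g w = (w : CharacterModule G) g := rfl

theorem mem_ker_evalOn (W₁ : AddSubgroup (CharacterModule G)) (g : G) :
    g ∈ (evalOn W₁).ker ↔ ∀ w ∈ W₁, (w : CharacterModule G) g = 0 := by
  rw [AddMonoidHom.mem_ker]
  constructor
  · intro h w hw
    exact DFunLike.congr_fun h ⟨w, hw⟩
  · intro h
    ext w
    exact h w w.2

/-- The characters of `G` vanishing on a subgroup `K`. -/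
def vanishingOn (K : AddSubgroup G) : AddSubgroup (CharacterModule G) where
  carrier := {χ | ∀ g ∈ K, χ g = 0}
  zero_mem' := fun g _ => rfl
  add_mem' := fun {χ ψ} hχ hψ g hg => by
    change χ g + ψ g = 0
    rw [hχ g hg, hψ g hg, add_zero]
  neg_mem' := fun {χ} hχ g hg => by
    change -(χ g) = 0
    rw [hχ g hg, neg_zero]

/-- **Finite Pontryagin biduality** (`W₁^{⊥⊥} = W₁`): a character of a FINITE abelian group that kills
the common kernel of a subgroup `W₁` of characters lies in `W₁`.  Counting proof:
`W₁ ≤ U := (ann W₁)^⊥`, `#U ≤ #(G ⧸ ann W₁)⋆ = #(G ⧸ ann W₁) = #range(eval) ≤ #W₁⋆ = #W₁`. -/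
theorem mem_of_forall_apply_eq_zero [Finite G] (W₁ : AddSubgroup (CharacterModule G))
    (t : CharacterModule G) (ht : ∀ g : G, (∀ w ∈ W₁, (w : CharacterModule G) g = 0) → t g = 0) :
    t ∈ W₁ := by
  classical
  haveI : Finite (CharacterModule G) := (finite_and_natCard_characterModule G).1
  set φ : G →+ CharacterModule W₁ := evalOn W₁ with hφ
  set K : AddSubgroup G := φ.ker with hK
  haveI : Finite W₁ := inferInstance
  haveI : Finite (CharacterModule W₁) := (finite_and_natCard_characterModule W₁).1
  haveI : Finite (CharacterModule (G ⧸ K)) := (finite_and_natCard_characterModule (G ⧸ K)).1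
  have hWU : W₁ ≤ vanishingOn K := fun w hw g hg => ((mem_ker_evalOn W₁ g).1 hg) w hw
  have htU : t ∈ vanishingOn K := fun g hg => ht g ((mem_ker_evalOn W₁ g).1 hg)
  -- `U ↪ (G ⧸ K)⋆`
  have h1 : Nat.card (vanishingOn K) ≤ Nat.card (CharacterModule (G ⧸ K)) := by
    refine Nat.card_le_card_of_injective
      (fun χ : vanishingOn K =>
        (QuotientAddGroup.lift K (χ : CharacterModule G) (fun g hg => χ.2 g hg) : CharacterModule (G ⧸ K)))
      ?_
    intro χ ψ h
    apply Subtype.ext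
    ext g
    exact DFunLike.congr_fun h (g : G ⧸ K)
  -- `#(G ⧸ K)⋆ = #(G ⧸ K) = #range φ ≤ #W₁⋆ = #W₁`
  have h2 : Nat.card (CharacterModule (G ⧸ K)) = Nat.card (G ⧸ K) :=
    (finite_and_natCard_characterModule (G ⧸ K)).2
  have h3 : Nat.card (G ⧸ K) = Nat.card φ.range :=
    Nat.card_congr (QuotientAddGroup.quotientKerEquivRange φ).toEquiv
  have h4 : Nat.card φ.range ≤ Nat.card (CharacterModule W₁) :=
    Nat.card_le_card_of_injective (fun x : φ.range => (x : CharacterModule W₁)) Subtype.val_injective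
  have h5 : Nat.card (CharacterModule W₁) = Nat.card W₁ := (finite_and_natCard_characterModule W₁).2
  have hcard : Nat.card (vanishingOn K) ≤ Nat.card W₁ := by
    calc Nat.card (vanishingOn K) ≤ Nat.card (CharacterModule (G ⧸ K)) := h1
      _ = Nat.card φ.range := by rw [h2, h3]
      _ ≤ Nat.card W₁ := by rw [← h5]; exact h4
  have hEq : W₁ = vanishingOn K := AddSubgroup.eq_of_le_of_card_ge hWU hcard
  rw [hEq]
  exact htU

/-- Restriction of characters to a subgroup `L₁ ≤ L`. -/
noncomputable def restrictChar {L : Type*} [AddCommGroup L] (L₁ : AddSubgroup L) :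
    CharacterModule L →+ CharacterModule L₁ :=
  AddMonoidHom.mk' (fun χ => (AddMonoidHom.comp χ L₁.subtype : L₁ →+ AddCircle (1 : ℚ)))
    (fun _ _ => AddMonoidHom.add_comp _ _ _)

theorem restrictChar_apply {L : Type*} [AddCommGroup L] (L₁ : AddSubgroup L)
    (χ : CharacterModule L) (ℓ : L₁) : restrictChar L₁ χ ℓ = χ (ℓ : L) := rfl

/-- **Finite-subgroup form of biduality** (`(CL-fin)`): for ANY abelian group `L`, any subgroup `W` of
characters and any `t ∈ W^{⊥⊥}`, on every FINITE subgroup `L₁ ≤ L` the character `t` agrees with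
some member of `W`.  (Apply the finite statement to `W|_{L₁} ≤ L₁⋆`.) -/
theorem exists_mem_eqOn_of_forall_ann {L : Type*} [AddCommGroup L]
    (W : AddSubgroup (CharacterModule L)) (t : CharacterModule L)
    (ht : ∀ ℓ : L, (∀ w ∈ W, (w : CharacterModule L) ℓ = 0) → t ℓ = 0)
    (L₁ : AddSubgroup L) [Finite L₁] :
    ∃ w ∈ W, ∀ ℓ ∈ L₁, (w : CharacterModule L) ℓ = t ℓ := by
  have hmem : restrictChar L₁ t ∈ W.map (restrictChar L₁) := by
    apply mem_of_forall_apply_eq_zero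
    intro g hg
    rw [restrictChar_apply]
    apply ht
    intro w hw
    have := hg _ (AddSubgroup.mem_map_of_mem (restrictChar L₁) hw)
    rwa [restrictChar_apply] at this
  obtain ⟨w, hw, hwt⟩ := AddSubgroup.mem_map.1 hmem
  refine ⟨w, hw, fun ℓ hℓ => ?_⟩
  have := DFunLike.congr_fun hwt ⟨ℓ, hℓ⟩
  rwa [restrictChar_apply, restrictChar_apply] at this

end FiniteBiduality

/-! ## §2 The dual-side cut of `S4rel` and its glue -/

section DualSideCut

variable {A : Type*} [CommRing A]
  {L : Type*} [AddCommGroup L] [Module A L]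
  {Sel : Type*} [AddCommGroup Sel] [Module A Sel]
  {H : Type*} [AddCommGroup H] [Module A H]
  (loc : Sel →ₗ[A] L) (locd : H →ₗ[A] CharacterModule L)

/-- `(DH)_rel` = `S4rel` (the binder `hDH` of p664041 / `hDHrel` of k3-g7 G3, with
`P := CharacterModule L`, `pair := CharacterModule.dual loc`): a character of `L` killing `loc(SelRel)`
is `locd x` up to a non-zero scalar. -/
def DeepHalf : Prop :=
  ∀ z : CharacterModule L, CharacterModule.dual loc z = 0 → ∃ a : A, a ≠ 0 ∧ ∃ x : H, a • z = locd x

/-- **S4d (DDH) — the DISCRETE deep half with uniform slack.**  Prover's interior (card §3 PLAN 2):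
ONE-level `LocalInvariants.SelmerComplement` for `⊥_S ≤ ⊤_S` per target `ℓ`, after converting
«`ℓ ⊥ locd(I.H)`» into «`res ℓ ⊥ loc H¹(G_S(ℚ_{m₁}), T/ϖ^{k₁})`» by (EVR) (§3 below) + the helper (κ);
the output is a DISCRETE class pushed into the direct limit `SelRel` (exact, no Kőnig on solutions). -/
def DiscreteDeepHalf : Prop :=
  ∃ a₀ : A, a₀ ≠ 0 ∧ ∀ ℓ : L, (∀ x : H, locd x ℓ = 0) → ∃ s : Sel, loc s = a₀ • ℓ

/-- `locd(I.H)` is Pontryagin-closed up to a scalar: `range locd ⊇ a • (range locd)^{⊥⊥}`. -/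
def ClosedImage : Prop :=
  ∀ z : CharacterModule L, (∀ ℓ : L, (∀ x : H, locd x ℓ = 0) → z ℓ = 0) →
    ∃ a : A, a ≠ 0 ∧ ∃ x : H, a • z = locd x

/-- **S4b (LW) — the COMPACT closure half, levelwise form.**  A character agreeing on every finite
subgroup of `L` with some `locd x` is `locd x` up to a non-zero scalar.  Prover's interior (card §3
PLAN 3): TP2's B9 limit bookkeeping (`Kato2004.IwasawaH1DataCoeff.proj_surjective/cores_proj`, landed
Kőnig `exists_compatible_preimage`, finiteness of `H¹(G_S(ℚ_n), T/ϖ^k)`, (κ)) on the solution sets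
«agrees with `t` on `L_N`» — NO Poitou–Tate input, no admissible sets. -/
def LevelwiseImage : Prop :=
  ∀ z : CharacterModule L,
    (∀ L₁ : AddSubgroup L, Finite L₁ → ∃ x : H, ∀ ℓ ∈ L₁, z ℓ = locd x ℓ) →
    ∃ a : A, a ≠ 0 ∧ ∃ x : H, a • z = locd x

/-- GLUE 1 (finite biduality ⇒): the levelwise half S4b gives the closure of `locd(I.H)`. -/
theorem closedImage_of_levelwise (hl : LevelwiseImage locd) : ClosedImage locd := by
  intro z hz
  refine hl z (fun L₁ hL₁ => ?_)
  haveI := hL₁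
  have hz' : ∀ ℓ : L, (∀ w ∈ (LinearMap.range locd).toAddSubgroup, (w : CharacterModule L) ℓ = 0) →
      z ℓ = 0 := by
    intro ℓ hℓ
    exact hz ℓ (fun x => hℓ (locd x)
      ((Submodule.mem_toAddSubgroup _).2 (LinearMap.mem_range_self locd x)))
  obtain ⟨w, hw, hwz⟩ := exists_mem_eqOn_of_forall_ann (LinearMap.range locd).toAddSubgroup z hz' L₁
  obtain ⟨x, hx⟩ := LinearMap.mem_range.1 ((Submodule.mem_toAddSubgroup _).1 hw)
  exact ⟨x, fun ℓ hℓ => by rw [← hwz ℓ hℓ, ← hx]⟩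

/-- **S4b′ (CW) — chainwise form** (prover-friendly: the solution sets are indexed by the level `N`
of a fixed tower `Lc N` of FINITE subgroups, e.g. the images of `⊕_{v∈S} H¹(ℚ_{N,v}, A_ρ[ϖ^N])`; no
exhaustion or monotonicity of the tower is needed for the glue direction). -/
def ChainwiseImage (Lc : ℕ → AddSubgroup L) : Prop :=
  ∀ z : CharacterModule L, (∀ N, ∃ x : H, ∀ ℓ ∈ Lc N, z ℓ = locd x ℓ) →
    ∃ a : A, a ≠ 0 ∧ ∃ x : H, a • z = locd x

/-- `S4b′ ⇒ S4b`: proving the chainwise form on ANY tower of finite subgroups (the prover's choice —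
an exhausting one, or the statement is hopeless) proves the canonical tower-free form. -/
theorem levelwiseImage_of_chainwise (Lc : ℕ → AddSubgroup L) [∀ N, Finite (Lc N)]
    (hl : ChainwiseImage locd Lc) : LevelwiseImage locd :=
  fun z hz => hl z (fun N => hz (Lc N) inferInstance)

/-- GLUE 1′: the chainwise half gives the closure of `locd(I.H)`. -/
theorem closedImage_of_chainwise (Lc : ℕ → AddSubgroup L) [∀ N, Finite (Lc N)]
    (hl : ChainwiseImage locd Lc) : ClosedImage locd :=
  closedImage_of_levelwise locd (levelwiseImage_of_chainwise locd Lc hl)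

/-- The conclusion is LITERALLY the deep-half binder consumed by p664041 / k3-g7 G3 (unfolding). -/
theorem deepHalf_iff :
    DeepHalf loc locd ↔
      ∀ z : CharacterModule L, CharacterModule.dual loc z = 0 → ∃ a : A, a ≠ 0 ∧ ∃ x : H, a • z = locd x :=
  Iff.rfl

variable [IsDomain A]

/-- GLUE 2: the discrete deep half S4d and the closure give `S4rel` (slacks multiply). -/
theorem deepHalf_of_discrete_of_closed (hd : DiscreteDeepHalf loc locd) (hc : ClosedImage locd) :
    DeepHalf loc locd := by
  intro z hz
  obtain ⟨a₀, ha₀, hd⟩ := hd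
  have hz' : ∀ s : Sel, z (loc s) = 0 := fun s => DFunLike.congr_fun hz s
  obtain ⟨a, ha, x, hx⟩ := hc (a₀ • z) (fun ℓ hℓ => by
    obtain ⟨s, hs⟩ := hd ℓ hℓ
    rw [CharacterModule.smul_apply, ← hs]
    exact hz' s)
  exact ⟨a * a₀, mul_ne_zero ha ha₀, x, by rw [mul_smul, hx]⟩

/-- **THE CUT**: `S4rel ⟸ S4d ∧ S4b`, glue kernel-checked. -/
theorem deepHalf_of_discrete_of_levelwise (hd : DiscreteDeepHalf loc locd) (hl : LevelwiseImage locd) :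
    DeepHalf loc locd :=
  deepHalf_of_discrete_of_closed loc locd hd (closedImage_of_levelwise locd hl)

/-- **THE CUT, prover-facing form**: `S4rel ⟸ S4d ∧ S4b′` for any tower of finite subgroups. -/
theorem deepHalf_of_discrete_of_chainwise (Lc : ℕ → AddSubgroup L) [∀ N, Finite (Lc N)]
    (hd : DiscreteDeepHalf loc locd) (hl : ChainwiseImage locd Lc) : DeepHalf loc locd :=
  deepHalf_of_discrete_of_closed loc locd hd (closedImage_of_chainwise locd Lc hl)

end DualSideCut

/-! ## §3 (EVR) «eventual range = image of the limit» for towers of finite sets -/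

section EventualRange

/-- A decreasing sequence of subsets of a finite type is eventually constant. -/
theorem exists_eventually_eq_of_antitone {α : Type*} [Finite α] (s : ℕ → Set α) (hs : Antitone s) :
    ∃ m₁, ∀ m, m₁ ≤ m → s m = s m₁ := by
  classical
  let c : ℕ → ℕ := fun m => (s m).ncard
  have hne : (Set.range c).Nonempty := ⟨c 0, 0, rfl⟩
  obtain ⟨m₁, hm₁⟩ := Nat.sInf_mem hne
  refine ⟨m₁, fun m hm => ?_⟩
  have hle : c m₁ ≤ c m := by
    rw [hm₁]
    exact Nat.sInf_le ⟨m, rfl⟩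
  exact Set.eq_of_subset_of_ncard_le (hs hm) hle (Set.toFinite _)

variable {X : ℕ → Type} (f : ∀ n, X (n + 1) → X n) (n₀ : ℕ)

/-- Iterated transition `X (n₀ + m) → X n₀`. -/
def iter : ∀ m : ℕ, X (n₀ + m) → X n₀
  | 0 => id
  | m + 1 => iter m ∘ f (n₀ + m)

theorem iter_succ (m : ℕ) (x : X (n₀ + (m + 1))) : iter f n₀ (m + 1) x = iter f n₀ m (f (n₀ + m) x) :=
  rfl

/-- The images `range (iter m)` decrease. -/
theorem antitone_range_iter : Antitone (fun m => Set.range (iter f n₀ m)) := by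
  refine antitone_nat_of_succ_le (fun m => ?_)
  rintro _ ⟨x, rfl⟩
  exact ⟨f (n₀ + m) x, rfl⟩

/-- **(EVR)** If `y ∈ X n₀` is hit from EVERY level (`y ∈ ⋂_m range (X (n₀+m) → X n₀)`), then `y`
extends to a compatible sequence — from the LANDED Kőnig lemma `exists_compatible_preimage`. -/
theorem exists_compatible_of_forall_mem_range [∀ n, Finite (X n)] (y : X n₀)
    (hy : ∀ m, ∃ x : X (n₀ + m), iter f n₀ m x = y) :
    ∃ x : ∀ m, X (n₀ + m), (∀ m, f (n₀ + m) (x (m + 1)) = x m) ∧ x 0 = y := by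
  obtain ⟨x, hx, hxy⟩ :=
    Summit.BirchSwinnertonDyer.BirchSwinnertonDyer.Theorems.CharIdealLambda.exists_compatible_preimage
      (H := fun m => X (n₀ + m)) (P := fun _ => X n₀)
      (fun m => f (n₀ + m)) (fun _ => id) (iter f n₀) (fun m x => rfl) (fun _ => y) (fun _ => rfl) hy
  exact ⟨x, hx, hxy 0⟩

/-- **(EVR′) eventual range**: there is ONE level `m₁` such that every `y` in the image of `X (n₀ + m₁)`
extends to a full compatible sequence (stabilisation + Kőnig).  This is the step of S4d that converts
«`ℓ ⊥` (classes that lift to the limit)» into «`ℓ ⊥` (all classes of ONE deep level)». -/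
theorem exists_level_range_subset_compatible [∀ n, Finite (X n)] :
    ∃ m₁, ∀ y : X n₀, y ∈ Set.range (iter f n₀ m₁) →
      ∃ x : ∀ m, X (n₀ + m), (∀ m, f (n₀ + m) (x (m + 1)) = x m) ∧ x 0 = y := by
  obtain ⟨m₁, hm₁⟩ := exists_eventually_eq_of_antitone _ (antitone_range_iter f n₀)
  refine ⟨m₁, fun y hy => exists_compatible_of_forall_mem_range f n₀ y (fun m => ?_)⟩
  by_cases h : m₁ ≤ m
  · have : y ∈ Set.range (iter f n₀ m) := by rw [hm₁ m h]; exact hy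
    exact this
  · exact antitone_range_iter f n₀ (not_le.mp h).le hy

end EventualRange

end Summit.BirchSwinnertonDyer.BirchSwinnertonDyer.Cruxes.ResidualThetaCountLowerPureAtTwo.StubIdeasK3G8
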